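import Literature.NumberTheory.EllipticCurves.DeuringFormValuation
import Literature.NumberTheory.EllipticCurves.TorsionCardinality
import Literature.NumberTheory.EllipticCurves.SpectralValuationUnramified
import Literature.NumberTheory.EllipticCurves.SelmerFiniteProofs
import Literature.NumberTheory.EllipticCurves.GaloisActionProofs
import Literature.NumberTheory.EllipticCurves.VariableChangePoints
import HarnessLib

/-!
# Unramified `3`-torsion at a place `v ∤ 3`: good reduction over `K_v^nr`, or `|j|_v > 1`

Topic `NumberTheory/EllipticCurves`. Let `E` be an elliptic curve over a number field `K`, `v` a
finite place with `v ∤ 3`, `K̄_v` with its spectral valuation `|·|_v`, `𝔐` the prime of the local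
absolute integers and `I_𝔐 ≤ Γ_{K_v}` its inertia group. We prove
(`WeierstrassCurve.exists_variableChange_inertia_or_one_lt_j_of_three_torsion`): **if `I_𝔐`
fixes every `P ∈ E(K̄_v)` with `3P = O`, then either some change of variables over `K̄_v` with
entries fixed by `I_𝔐` makes `E` integral for `|·|_v` with unit discriminant, or `|j(E)|_v > 1`.**

This is the step "`E[m]` unramified ⟹ good or (potentially) multiplicative reduction" of the
criterion of Néron–Ogg–Shafarevich (Silverman, *AEC*, Thm. VII.7.1) at residue characteristic
`≠ 3` (needed at the places above `2`), obtained without Néron models from the normal form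
`y² + a₁xy + a₃y = x³` attached to a point of order `3` (Silverman, *AEC*, App. A, Prop. 1.3 and
the proof of Cor. A.1.4(a); file `DeuringFormValuation`): a point `P` of order `3` is defined
over `K_v^nr`, so are the coefficients `a₁, a₃` of the resulting equation
(`smul_eq_of_three_torsion`); the valuations of elements of `K_v^nr` are integral powers of
`|ϖ|` (`exists_spectralValuation_eq_zpow_of_forall_inertia`), and a rescaling by a power of `ϖ`
normalises to `|a₁| ≤ 1 = |a₃|` — in the case `|a₁|³ < |a₃|` because `ord(a₃) ∈ 3ℤ`, which is
read off from the abscissa of a *second* unramified `3`-torsion point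
(`val_pow_three_eq_of_eval_eq_zero`: `|x|³ = |a₃|²`) — unless `|a₃| < |a₁|³`, where `|j| > 1`
(`one_lt_val_j_of_lt`); in normalised form `Δ = a₃³(a₁³ - 27a₃)` is a unit or `|j| > 1`
(`val_Δ_eq_one_or_one_lt_val_j`).

## References

* [SilvermanAEC2009] J. H. Silverman, *The Arithmetic of Elliptic Curves*, 2nd ed., GTM 106,
  Springer 2009: Exercise 3.9(a), Cor. III.6.4, App. A Prop. 1.3 and proof of Cor. 1.4(a)
  (PDF pp. 356–357), Thm. VII.7.1.
-/

noncomputable section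

open scoped Classical NNReal

universe u

open NumberField IsDedekindDomain Field

namespace WeierstrassCurve

open Literature.NumberTheory.EllipticCurves Literature.NumberTheory.GaloisRepresentations
  IsDedekindDomain.HeightOneSpectrum

variable {K : Type u} [Field K] [NumberField K] (W : WeierstrassCurve K) {v : HeightOneSpectrum (𝓞 K)}
  {w : Valuation (AlgebraicClosure (v.adicCompletion K)) ℝ≥0}
  (hw : ∀ x, (w x : ℝ) = spectralNorm (v.adicCompletion K) (AlgebraicClosure (v.adicCompletion K)) x)

/-- Transport of `n`-torsion along an isomorphism of groups (private copy of
`AddEquiv.natCard_torsionBy_eq` of `PotentiallyMultiplicativeRamifiedTorsion`). [folklore] -/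
private theorem natCard_torsionBy_congr {A B : Type*} [AddCommGroup A] [AddCommGroup B]
    (e : A ≃+ B) (n : ℤ) :
    Nat.card (AddSubgroup.torsionBy A n) = Nat.card (AddSubgroup.torsionBy B n) := by
  refine Nat.card_congr ((e : A ≃ B).subtypeEquiv fun a => ?_)
  change a ∈ AddSubgroup.torsionBy A n ↔ e a ∈ AddSubgroup.torsionBy B n
  rw [AddSubgroup.torsionBy, AddSubgroup.torsionBy, Submodule.mem_toAddSubgroup,
    Submodule.mem_toAddSubgroup, Submodule.mem_torsionBy_iff, Submodule.mem_torsionBy_iff,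
    ← map_zsmul, e.map_eq_zero_iff]

/-! ## Valuations of elements of `K_v^nr` are integral powers of `|ϖ|` -/

include hw in
/-- A non-zero element of `K̄_v` fixed by the inertia group `I_𝔐` (i.e. an element of `K_v^nr`)
has valuation `|ϖ|ᵏ` for some `k ∈ ℤ`: `K_v^nr / K_v` is unramified (from
`exists_spectralValuation_eq_pow_of_forall_inertia`, applied to `x` or `x⁻¹`). [folklore] -/
theorem _root_.IsDedekindDomain.HeightOneSpectrum.exists_spectralValuation_eq_zpow_of_forall_inertia
    {𝔐 : Ideal v.localAbsIntegers}
    (h𝔐 : 𝔐 ∈ v.localPrimesAbove) {ϖ : v.adicCompletionIntegers K} (hϖ : Irreducible ϖ)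
    {x : AlgebraicClosure (v.adicCompletion K)}
    (hx : ∀ σ ∈ 𝔐.inertia (absoluteGaloisGroup (v.adicCompletion K)),
      absoluteGaloisGroup.toAlgEquiv (v.adicCompletion K) σ x = x)
    (hx0 : x ≠ 0) :
    ∃ k : ℤ, w x =
      w (algebraMap (v.adicCompletion K) (AlgebraicClosure (v.adicCompletion K))
        (ϖ : v.adicCompletion K)) ^ k := by
  have hwx : 0 < w x := (Valuation.pos_iff _).mpr hx0
  rcases lt_trichotomy (w x) 1 with hlt | heq | hgt
  · obtain ⟨m, -, hm⟩ := exists_spectralValuation_eq_pow_of_forall_inertia hw h𝔐 hϖ hx hwx hlt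
    exact ⟨m, by rw [zpow_natCast, hm]⟩
  · exact ⟨0, by rw [zpow_zero, heq]⟩
  · have hx' : ∀ σ ∈ 𝔐.inertia (absoluteGaloisGroup (v.adicCompletion K)),
        absoluteGaloisGroup.toAlgEquiv (v.adicCompletion K) σ x⁻¹ = x⁻¹ := fun σ hσ => by
      rw [map_inv₀, hx σ hσ]
    have h0 : 0 < w x⁻¹ := by rw [map_inv₀]; exact inv_pos.mpr hwx
    have h1 : w x⁻¹ < 1 := by rw [map_inv₀]; exact inv_lt_one_of_one_lt₀ hgt
    obtain ⟨m, -, hm⟩ := exists_spectralValuation_eq_pow_of_forall_inertia hw h𝔐 hϖ hx' h0 h1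
    refine ⟨-(m : ℤ), ?_⟩
    rw [zpow_neg, zpow_natCast, ← hm, map_inv₀, inv_inv]

/-! ## The main theorem -/

/-- On `V : y² + pxy + qy = x³`: if the `3`-torsion subgroup of `V(F)` has more than `3`
elements, then some `3`-torsion point has non-zero abscissa (the line `x = 0` meets `V` only in
`(0, 0)` and `(0, -q)`). [folklore] -/
theorem exists_three_torsion_x_ne_zero {F : Type*} [Field F] [DecidableEq F] {p q : F}
    (hcard : 3 < Nat.card (AddSubgroup.torsionBy
      (⟨p, 0, q, 0, 0⟩ : WeierstrassCurve F).toAffine.Point 3)) :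
    ∃ (x y : F) (h : (⟨p, 0, q, 0, 0⟩ : WeierstrassCurve F).toAffine.Nonsingular x y),
      (3 : ℤ) • (Affine.Point.some x y h) = 0 ∧ x ≠ 0 := by
  by_contra hno
  push Not at hno
  set S := (AddSubgroup.torsionBy (⟨p, 0, q, 0, 0⟩ : WeierstrassCurve F).toAffine.Point 3 :
    Set (⟨p, 0, q, 0, 0⟩ : WeierstrassCurve F).toAffine.Point) with hS
  have hmem : ∀ P, P ∈ S ↔ (3 : ℤ) • P = 0 := fun P => by
    rw [hS, SetLike.mem_coe]; exact Submodule.mem_torsionBy_iff _ _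
  -- `y`-coordinate map, injective on `S`, with image in `{none, some 0, some (-q)}`
  let g : (⟨p, 0, q, 0, 0⟩ : WeierstrassCurve F).toAffine.Point → Option F := fun P =>
    match P with
    | .zero => none
    | .some _ y _ => some y
  have hx0 : ∀ {x y : F} {h : (⟨p, 0, q, 0, 0⟩ : WeierstrassCurve F).toAffine.Nonsingular x y},
      Affine.Point.some x y h ∈ S → x = 0 := by
    intro x y h hP
    exact hno x y h ((hmem _).mp hP)
  have hinj : Set.InjOn g S := by
    rintro (_ | ⟨x, y, h⟩) hP (_ | ⟨x', y', h'⟩) hP' hg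
    · rfl
    · exact absurd hg (by simp [g])
    · exact absurd hg (by simp [g])
    · simp only [g, Option.some.injEq] at hg
      have hxx := (hx0 hP).trans (hx0 hP').symm
      subst hxx hg
      rfl
  have hmaps : Set.MapsTo g S ({none, some 0, some (-q)} : Set (Option F)) := by
    rintro (_ | ⟨x, y, h⟩) hP
    · simp [g]
    · have hx := hx0 hP
      have heq := (Affine.equation_iff x y).mp h.1
      simp only [hx] at heq
      have hy : y * (y + q) = 0 := by linear_combination heq
      rcases mul_eq_zero.mp hy with hy | hy
      · simp [g, hy]
      · simp [g, eq_neg_of_add_eq_zero_left hy]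
  have hfin : ({none, some 0, some (-q)} : Set (Option F)).Finite := by
    exact Set.toFinite _
  have hle := Set.ncard_le_ncard_of_injOn g hmaps hinj hfin
  have h3 : ({none, some 0, some (-q)} : Set (Option F)).ncard ≤ 3 := by
    refine (Set.ncard_insert_le _ _).trans ?_
    refine Nat.succ_le_succ ((Set.ncard_insert_le _ _).trans ?_)
    rw [Set.ncard_singleton]
  have hcS : Nat.card (AddSubgroup.torsionBy
      (⟨p, 0, q, 0, 0⟩ : WeierstrassCurve F).toAffine.Point 3) = S.ncard :=
    Nat.card_coe_set_eq S
  rw [hcS] at hcard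
  omega

include hw in
/-- **Unramified `3`-torsion at `v ∤ 3`: good reduction over `K_v^nr` or `|j|_v > 1`.** Let `E` be
an elliptic curve over a number field `K`, `v ∤ 3` a finite place, and suppose the inertia group
`I_𝔐 ≤ Γ_{K_v}` fixes every `P ∈ E(K̄_v)` with `3P = O`. Then either there is a change of
variables `C` over `K̄_v` with entries fixed by `I_𝔐` such that `C • E_{K̄_v}` is integral for
`|·|_v` with `|Δ|_v = 1` (good reduction over `K_v^nr`), or `|j(E)|_v > 1`. (Silverman, *AEC*,
Thm. VII.7.1 with App. A Prop. 1.3 / Cor. 1.4(a) in place of Néron models: the equation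
`y² + a₁xy + a₃y = x³` attached to an unramified point of order `3` has coefficients in `K_v^nr`;
normalised by a power of `ϖ` it has unit `Δ` or exhibits `|j| > 1`.)
[cite: SilvermanAEC2009, Thm. VII.7.1 (proof) with App. A, Prop. 1.3 and Cor. 1.4(a)] -/
theorem exists_variableChange_inertia_or_one_lt_j_of_three_torsion [W.IsElliptic]
    {𝔐 : Ideal v.localAbsIntegers} (h𝔐 : 𝔐 ∈ v.localPrimesAbove) (h3v : (3 : 𝓞 K) ∉ v.asIdeal)
    (hfix : ∀ σ ∈ 𝔐.inertia (absoluteGaloisGroup (v.adicCompletion K)),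
      ∀ P : localPoints W (v.adicCompletion K), 3 • P = 0 → σ • P = P) :
    (∃ C : VariableChange (AlgebraicClosure (v.adicCompletion K)),
      (∀ σ ∈ 𝔐.inertia (absoluteGaloisGroup (v.adicCompletion K)),
        absoluteGaloisGroup.toAlgEquiv (v.adicCompletion K) σ (C.u : AlgebraicClosure _) = C.u ∧
        absoluteGaloisGroup.toAlgEquiv (v.adicCompletion K) σ C.r = C.r ∧
        absoluteGaloisGroup.toAlgEquiv (v.adicCompletion K) σ C.s = C.s ∧
        absoluteGaloisGroup.toAlgEquiv (v.adicCompletion K) σ C.t = C.t) ∧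
      (C • W.baseChange (AlgebraicClosure (v.adicCompletion K))).IsIntegral w.integer ∧
      w (C • W.baseChange (AlgebraicClosure (v.adicCompletion K))).Δ = 1) ∨
    1 < w (algebraMap K (AlgebraicClosure (v.adicCompletion K)) W.j) := by
  set L := AlgebraicClosure (v.adicCompletion K)
  set τ := absoluteGaloisGroup.toAlgEquiv (v.adicCompletion K) with hτ
  set f := algebraMap (v.adicCompletion K) L with hf
  set WL := W.baseChange L with hWL
  haveI : CharZero L := charZero_of_injective_algebraMap (algebraMap K L).injective
  have hw3 : w (3 : L) = 1 := by
    have := spectralValuation_intCast_eq_one hw (n := 3) (by exact_mod_cast h3v)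
    exact_mod_cast this
  have hfixK : ∀ (σ : absoluteGaloisGroup (v.adicCompletion K)) (a : K),
      τ σ (algebraMap K L a) = algebraMap K L a := fun σ a => by
    rw [IsScalarTower.algebraMap_apply K (v.adicCompletion K) L]; exact AlgEquiv.commutes _ _
  have hfixa : ∀ σ : absoluteGaloisGroup (v.adicCompletion K),
      τ σ WL.a₁ = WL.a₁ ∧ τ σ WL.a₂ = WL.a₂ ∧ τ σ WL.a₃ = WL.a₃ ∧ τ σ WL.a₄ = WL.a₄ :=
    fun σ => ⟨hfixK σ W.a₁, hfixK σ W.a₂, hfixK σ W.a₃, hfixK σ W.a₄⟩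
  -- coordinates of `3`-torsion points are fixed by inertia
  have hfixc : ∀ σ ∈ 𝔐.inertia (absoluteGaloisGroup (v.adicCompletion K)),
      ∀ {x y : L} {h : WL.toAffine.Nonsingular x y},
        3 • (Affine.Point.some x y h : WL.toAffine.Point) = 0 → τ σ x = x ∧ τ σ y = y := by
    intro σ hσ x y h h3
    have hP := hfix σ hσ (Affine.Point.some x y h) h3
    rw [localPoints.smul_def] at hP
    change Affine.Point.map _ (Affine.Point.some x y h) = _ at hP
    rw [Affine.Point.map_some, Affine.Point.some.injEq] at hP
    exact hP
  obtain ⟨ϖ, hϖ⟩ := IsDiscreteValuationRing.exists_irreducible (v.adicCompletionIntegers K)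
  obtain ⟨hc0, hc1⟩ := spectralValuation_uniformizer_pos_lt_one hw hϖ
  set c := w (f (ϖ : v.adicCompletion K)) with hc
  -- (a) a point `P = (x₀, y₀)` of order `3`
  have hc3 : Nat.card (torsionPoints W L 3) = 3 ^ 2 :=
    W.card_torsionPoints_eq_sq_holds L (n := 3) (by norm_num)
  haveI : Finite (torsionPoints W L 3) := Nat.finite_of_card_ne_zero (by rw [hc3]; norm_num)
  have hnt : Nontrivial (torsionPoints W L 3) := by
    rw [← Finite.one_lt_card_iff_nontrivial, hc3]; norm_num
  obtain ⟨⟨P, hP⟩, hP0⟩ := exists_ne (0 : torsionPoints W L 3)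
  have hP3 : 3 • P = 0 := by
    have := hP
    rwa [mem_torsionPoints_iff, show (3 : ℤ) = ((3 : ℕ) : ℤ) from rfl, natCast_zsmul] at this
  have hPne : P ≠ 0 := fun h => hP0 (Subtype.ext h)
  rcases P with _ | ⟨x₀, y₀, h₀⟩
  · exact absurd rfl hPne
  -- (b) tangent slope and the order-`3` relation
  have hnegY : WL.toAffine.negY x₀ y₀ = -y₀ - WL.a₁ * x₀ - WL.a₃ := rfl
  have hyne : y₀ ≠ WL.toAffine.negY x₀ y₀ := by
    intro hy
    have h2 : (Affine.Point.some x₀ y₀ h₀ : WL.toAffine.Point) + Affine.Point.some x₀ y₀ h₀ = 0 :=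
      Affine.Point.add_self_of_Y_eq hy
    apply hPne
    rw [show (3 : ℕ) = 2 + 1 from rfl, succ_nsmul, two_nsmul, h2, zero_add] at hP3
    exact hP3
  set la := WL.toAffine.slope x₀ x₀ y₀ y₀ with hla
  have hden : 2 * y₀ + WL.a₁ * x₀ + WL.a₃ ≠ 0 := by
    intro h0; apply hyne; rw [hnegY]; linear_combination h0
  have hlarel : la * (2 * y₀ + WL.a₁ * x₀ + WL.a₃) =
      3 * x₀ ^ 2 + 2 * WL.a₂ * x₀ + WL.a₄ - WL.a₁ * y₀ := by
    rw [hla, Affine.slope_of_Y_ne rfl hyne, hnegY,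
      show y₀ - (-y₀ - WL.a₁ * x₀ - WL.a₃) = 2 * y₀ + WL.a₁ * x₀ + WL.a₃ by ring,
      div_mul_cancel₀ _ hden]
  have h3rel : la ^ 2 + WL.a₁ * la - WL.a₂ - 3 * x₀ = 0 := by
    have h2 : (2 : ℕ) • (Affine.Point.some x₀ y₀ h₀ : WL.toAffine.Point) =
        -Affine.Point.some x₀ y₀ h₀ := by
      rw [eq_neg_iff_add_eq_zero, ← succ_nsmul]; exact hP3
    rw [two_nsmul, Affine.Point.add_self_of_Y_ne hyne, Affine.Point.neg_some,
      Affine.Point.some.injEq] at h2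
    have := h2.1
    rw [Affine.addX] at this
    linear_combination this
  -- (c) the equation `y² + b₁xy + b₃y = x³` over `K_v^nr`
  have hfix0 : ∀ σ ∈ 𝔐.inertia (absoluteGaloisGroup (v.adicCompletion K)),
      τ σ x₀ = x₀ ∧ τ σ y₀ = y₀ := fun σ hσ => hfixc σ hσ hP3
  have hfixla : ∀ σ ∈ 𝔐.inertia (absoluteGaloisGroup (v.adicCompletion K)), τ σ la = la := by
    intro σ hσ
    obtain ⟨fx, fy⟩ := hfix0 σ hσ
    obtain ⟨f1, f2, f3, f4⟩ := hfixa σ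
    have h' : τ σ la * (2 * y₀ + WL.a₁ * x₀ + WL.a₃) =
        3 * x₀ ^ 2 + 2 * WL.a₂ * x₀ + WL.a₄ - WL.a₁ * y₀ := by
      have := congrArg (τ σ) hlarel
      simp only [map_mul, map_add, map_sub, map_pow, map_ofNat, fx, fy, f1, f2, f3, f4] at this
      exact this
    exact mul_right_cancel₀ hden (h'.trans hlarel.symm)
  set C₁ : VariableChange L := ⟨1, x₀, la, y₀⟩ with hC₁
  set b₁ := WL.a₁ + 2 * la with hb₁
  set b₃ := 2 * y₀ + WL.a₁ * x₀ + WL.a₃ with hb₃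
  have hD : C₁ • WL = ⟨b₁, 0, b₃, 0, 0⟩ := smul_eq_of_three_torsion WL h₀.1 hlarel h3rel
  have hfixb₁ : ∀ σ ∈ 𝔐.inertia (absoluteGaloisGroup (v.adicCompletion K)), τ σ b₁ = b₁ := by
    intro σ hσ
    rw [hb₁, map_add, map_mul, map_ofNat, (hfixa σ).1, hfixla σ hσ]
  have hfixb₃ : ∀ σ ∈ 𝔐.inertia (absoluteGaloisGroup (v.adicCompletion K)), τ σ b₃ = b₃ := by
    intro σ hσ
    obtain ⟨fx, fy⟩ := hfix0 σ hσ
    rw [hb₃, map_add, map_add, map_mul, map_mul, map_ofNat, (hfixa σ).1, (hfixa σ).2.2.1, fx, fy]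
  have hb₃0 : b₃ ≠ 0 := hden
  have hQ0 : 0 < w b₃ := (Valuation.pos_iff _).mpr hb₃0
  -- `j` is that of `W`
  haveI hDell : (⟨b₁, 0, b₃, 0, 0⟩ : WeierstrassCurve L).IsElliptic := by
    rw [← hD]; infer_instance
  have key_j : ∀ (X : WeierstrassCurve L) (C : VariableChange L) (hX : X = C • WL)
      [X.IsElliptic], X.j = algebraMap K L W.j := by
    intro X C hX _
    subst hX
    exact (variableChange_j WL C).trans (W.map_j (algebraMap K L))
  -- (d) Case `|b₃| < |b₁|³`: `|j| > 1`
  rcases lt_or_ge (w b₃) (w b₁ ^ 3) with hIII | hI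
  · right
    have := one_lt_val_j_of_lt hw3 hb₃0 hIII
    rwa [key_j _ C₁ hD.symm] at this
  -- (e) otherwise: a power `u = ϖᵏ` with `|u|³ = |b₃|` and `|b₁| ≤ |u|`
  obtain ⟨k, hk, hk₁⟩ : ∃ k : ℤ, w b₃ = (c ^ k) ^ 3 ∧ w b₁ ≤ c ^ k := by
    rcases hI.lt_or_eq with hI | hII
    · -- `|b₁|³ < |b₃|`: `ord b₃ ∈ 3ℤ` from a second `3`-torsion point
      have hcard : 3 < Nat.card (AddSubgroup.torsionBy
          (⟨b₁, 0, b₃, 0, 0⟩ : WeierstrassCurve L).toAffine.Point 3) := by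
        rw [← natCard_torsionBy_congr ((VariableChange.pointEquiv WL C₁).trans
          (Affine.Point.congrEquiv hD)) 3]
        change 3 < Nat.card (torsionPoints W L 3)
        rw [hc3]; norm_num
      obtain ⟨x₁, y₁, h₁, h3₁, hx₁⟩ := exists_three_torsion_x_ne_zero hcard
      -- `x₁` is fixed by inertia: it is `x - x₀` for a `3`-torsion point `(x, y)` of `W`
      have hfixx₁ : ∀ σ ∈ 𝔐.inertia (absoluteGaloisGroup (v.adicCompletion K)), τ σ x₁ = x₁ := by
        intro σ hσ
        set e := (VariableChange.pointEquiv WL C₁).trans (Affine.Point.congrEquiv hD) with he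
        obtain ⟨R, hR⟩ := e.surjective (Affine.Point.some x₁ y₁ h₁)
        have hR3 : 3 • R = 0 := by
          apply e.injective
          rw [map_nsmul, hR, map_zero, ← natCast_zsmul]; exact h3₁
        rcases R with _ | ⟨x, y, h⟩
        · exact absurd ((map_zero e).symm.trans hR) (Affine.Point.some_ne_zero h₁).symm
        · rw [he, AddEquiv.trans_apply, VariableChange.pointEquiv_some,
            Affine.Point.congrEquiv_some, Affine.Point.some.injEq] at hR
          obtain ⟨fx, -⟩ := hfixc σ hσ hR3
          rw [← hR.1, VariableChange.toX_def, hC₁]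
          simp only [inv_one, Units.val_one, one_pow, one_mul, map_sub, fx, (hfix0 σ hσ).1]
      have hcubic : 3 * x₁ ^ 3 + b₁ ^ 2 * x₁ ^ 2 + 3 * (b₁ * b₃) * x₁ + 3 * b₃ ^ 2 = 0 := by
        have h' := (zsmul_some_eq_zero_iff_eval_ΨSq _ h₁ 3).mp h3₁
        rw [ΨSq_three, Polynomial.eval_pow, pow_eq_zero_iff two_ne_zero, eval_Ψ₃_threeTorsionForm] at h'
        exact (mul_eq_zero.mp h').resolve_left hx₁
      have hval := val_pow_three_eq_of_eval_eq_zero hw3 hb₃0 hI hcubic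
      obtain ⟨k₁, hk₁⟩ := exists_spectralValuation_eq_zpow_of_forall_inertia hw h𝔐 hϖ hfixx₁ hx₁
      obtain ⟨m₃, hm₃⟩ := exists_spectralValuation_eq_zpow_of_forall_inertia hw h𝔐 hϖ hfixb₃ hb₃0
      rw [hk₁, hm₃, ← hc, ← zpow_natCast, ← zpow_mul, ← zpow_natCast, ← zpow_mul] at hval
      have hinj := zpow_right_injective₀ hc0 hc1.ne hval
      push_cast at hinj
      obtain ⟨k, hk⟩ : (3 : ℤ) ∣ m₃ := by
        have : (3 : ℤ) ∣ 2 * m₃ := ⟨k₁, by linarith⟩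
        exact (Int.isCoprime_iff_gcd_eq_one.mpr rfl).dvd_of_dvd_mul_left this
      refine ⟨k, ?_, ?_⟩
      · rw [hm₃, ← hc, hk, ← zpow_natCast, ← zpow_mul, mul_comm]; rfl
      · by_contra hlt
        rw [not_le] at hlt
        have : (c ^ k) ^ 3 < w b₁ ^ 3 := pow_lt_pow_left₀ hlt zero_le three_ne_zero
        rw [hm₃, ← hc, hk, show c ^ (3 * k) = (c ^ k) ^ 3 by
          rw [← zpow_natCast, ← zpow_mul, mul_comm]; rfl] at hI
        exact absurd (hI.trans this) (lt_irrefl _)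
    · -- `|b₁|³ = |b₃|`: take `|u| = |b₁|`
      have hb₁0 : b₁ ≠ 0 := by
        intro h0; rw [h0, map_zero, zero_pow three_ne_zero] at hII; exact hQ0.ne hII
      obtain ⟨k, hk⟩ := exists_spectralValuation_eq_zpow_of_forall_inertia hw h𝔐 hϖ hfixb₁ hb₁0
      exact ⟨k, by rw [← hk, hII], hk.le⟩
  -- the rescaled equation
  set u : L := f (ϖ : v.adicCompletion K) ^ k with hu
  have hu0 : u ≠ 0 := by
    rw [hu]; refine zpow_ne_zero _ ?_
    rw [← (Valuation.ne_zero_iff w), ← hc]; exact hc0.ne'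
  have hwu : w u = c ^ k := by rw [hu, map_zpow₀, hc]
  have hfixu : ∀ σ : absoluteGaloisGroup (v.adicCompletion K), τ σ u = u := fun σ => by
    rw [hu, map_zpow₀, hf, AlgEquiv.commutes]
  set C : VariableChange L := ⟨Units.mk0 u hu0, 0, 0, 0⟩ * C₁ with hC
  have hCW : C • WL = ⟨b₁ / u, 0, b₃ / u ^ 3, 0, 0⟩ := by
    rw [hC, mul_smul, hD]; exact smul_threeTorsionForm hu0 b₁ b₃
  have hp : w (b₁ / u) ≤ 1 := by
    rw [map_div₀, hwu]; exact div_le_one_of_le₀ hk₁ zero_le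
  have hq : w (b₃ / u ^ 3) = 1 := by
    rw [map_div₀, map_pow, hwu, hk, div_self]
    exact pow_ne_zero _ (zpow_ne_zero _ hc0.ne')
  have hCfix : ∀ σ ∈ 𝔐.inertia (absoluteGaloisGroup (v.adicCompletion K)),
      τ σ (C.u : L) = C.u ∧ τ σ C.r = C.r ∧ τ σ C.s = C.s ∧ τ σ C.t = C.t := by
    intro σ hσ
    obtain ⟨fx, fy⟩ := hfix0 σ hσ
    simp only [hC, hC₁, VariableChange.mul_def, Units.val_mk0, Units.val_one,
      mul_one, one_pow, zero_mul, zero_add, mul_zero, add_zero]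
    exact ⟨hfixu σ, fx, hfixla σ hσ, fy⟩
  haveI hEll : (⟨b₁ / u, 0, b₃ / u ^ 3, 0, 0⟩ : WeierstrassCurve L).IsElliptic := by
    rw [← hCW]; infer_instance
  rcases val_Δ_eq_one_or_one_lt_val_j hw3 hp hq with hΔ | hj
  · left
    refine ⟨C, hCfix, ?_, ?_⟩
    · rw [hCW]; exact isIntegral_threeTorsionForm hp hq.le
    · rw [hCW]; exact hΔ
  · right
    rwa [key_j _ C hCW.symm] at hj

end WeierstrassCurve

end
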